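import Literature.NumberTheory.Automorphic.IntegratedOperator          -- ★ `ContRepresentation.integratedOperator`, `integratedOperator_apply`
import Literature.NumberTheory.Automorphic.HaarConjCompact             -- ★ `map_mul_right_eq_self_of_mem_isCompact` (a Haar measure is right-invariant under compact subgroups)
import HarnessLib

/-!
# Test functions right-invariant under an open subgroup: bi-invariance under a smaller open subgroup, and absorption `π(F) ∘ π(k) = π(F)`
# for `k` in a COMPACT subgroup with a Haar (not necessarily right-invariant) measure

Topic `NumberTheory/Automorphic`; namespace `Literature.NumberTheory.Automorphic`.  THEOREMS ONLY (no definition, no instance, no notation, no named fact,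
no `sorry`).  Cell `hodgecm-mathlib`, programme P3 «U3-mult», ROAD «TF» (assembler J2 of `ArchFinTraceSplit`), two generic lemmas:
* `exists_subgroup_forall_mul_eq_of_forall_mul_right` — a compactly supported `f : G → ℂ` on a topological group which is right-invariant under an OPEN
  subgroup `K` is BI-invariant under the open subgroup `K ⊓ ⋂_{x ∈ t} x K x⁻¹`, `t` finite with `tsupport f ⊆ ⋃_{x ∈ t} x K` — no non-archimedean structure
  on `G` is needed (for `U(H)(𝔸_f)` the tree has no `NonarchimedeanGroup` instance, so ★ `exists_isCompact_isOpen_forall_mul_eq` does not apply);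
* `ContRepresentation.integratedOperator_comp_apply_eq_self_of_mem_isCompact` — `π(F) ∘ π(k) = π(F)` for `F ∈ C_c(G)` right-invariant under a COMPACT subgroup
  `K ∋ k` and a HAAR measure: ★ `integratedOperator_comp_apply_eq_self_of_forall_mul_eq` asks for a right-invariant measure, here replaced by the right-invariance
  of Haar measures under compact subgroups (★ `map_mul_right_eq_self_of_mem_isCompact`, modular character trivial on compacta) — no unimodularity.
[BorelJacquet1979, §4.1]; [DeitmarEchterhoff2014, Lemma 1.6.3, §9.2]; [Bourbaki, *Intégration* VII §1 no. 3].  HONEST LABEL: generic; HC_CM is proved only modulo the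
printed citations until rung 0 closes, and this file moves no count.

## References
* A. Borel, H. Jacquet, *Automorphic forms and automorphic representations*, PSPM 33.1 (1979), §4.1 [BorelJacquet1979].
* A. Deitmar, S. Echterhoff, *Principles of Harmonic Analysis*, 2nd ed. (2014), Lemma 1.6.3 [DeitmarEchterhoff2014].
-/

set_option autoImplicit false

noncomputable section

open MeasureTheory CompactlySupported Filter Topology

namespace Literature.NumberTheory.Automorphic

/-- **A compactly supported function which is right-invariant under an OPEN subgroup `K` is BI-INVARIANT under an open subgroup `K″ ≤ K`**:
`K″ = K ⊓ ⋂_{x ∈ t} x K x⁻¹` for a finite `t` with `tsupport f ⊆ ⋃_{x ∈ t} x K` (no non-archimedean structure needed). [folklore] [cite: BorelJacquet1979, §4.1] -/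
theorem exists_subgroup_forall_mul_eq_of_forall_mul_right {G : Type*} [Group G] [TopologicalSpace G] [IsTopologicalGroup G]
    (K : Subgroup G) (hKo : IsOpen (K : Set G)) (f : G → ℂ) (hf : HasCompactSupport f) (hfK : ∀ k ∈ K, ∀ x, f (x * k) = f x) :
    ∃ K' : Subgroup G, K' ≤ K ∧ IsOpen (K' : Set G) ∧ (∀ k ∈ K', ∀ x, f (x * k) = f x) ∧ (∀ k ∈ K', ∀ x, f (k * x) = f x) := by
  -- finite subcover of the support by cosets `x K`
  have hcov : tsupport f ⊆ ⋃ x : G, (fun k => x * k) '' (K : Set G) := fun x _ =>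
    Set.mem_iUnion.2 ⟨x, 1, K.one_mem, mul_one x⟩
  obtain ⟨t, ht⟩ := hf.elim_finite_subcover (fun x => (fun k => x * k) '' (K : Set G)) (fun x => (isOpenMap_mul_left x) _ hKo) hcov
  -- the conjugates `x K x⁻¹` as subgroups
  let C : G → Subgroup G := fun x => K.map (MulAut.conj x).toMonoidHom
  have hCmem : ∀ x k, k ∈ C x ↔ x⁻¹ * k * x ∈ K := fun x k => by
    change k ∈ K.map (MulAut.conj x).toMonoidHom ↔ _
    rw [Subgroup.mem_map_equiv, MulAut.conj_symm_apply]
  have hCo : ∀ x, IsOpen (C x : Set G) := fun x => by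
    have : (C x : Set G) = (fun k => x⁻¹ * k * x) ⁻¹' (K : Set G) := Set.ext fun k => hCmem x k
    rw [this]
    exact hKo.preimage ((continuous_const.mul continuous_id).mul continuous_const)
  refine ⟨K ⊓ ⨅ x ∈ t, C x, inf_le_left, ?_, fun k hk x => hfK k hk.1 x, fun k hk y => ?_⟩
  · have hset : ((K ⊓ ⨅ x ∈ t, C x : Subgroup G) : Set G) = (K : Set G) ∩ ⋂ x ∈ t, (C x : Set G) := by
      simp [Subgroup.coe_inf, Subgroup.coe_iInf]
    rw [hset]
    exact hKo.inter (t.finite_toSet.isOpen_biInter fun x _ => hCo x)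
  · have hk' : ∀ x ∈ t, x⁻¹ * k * x ∈ K := fun x hx =>
      (hCmem x k).1 ((Subgroup.mem_iInf.1 ((Subgroup.mem_iInf.1 hk.2) x)) hx)
    by_cases hy : y ∈ ⋃ x ∈ t, (fun k => x * k) '' (K : Set G)
    · obtain ⟨x, hx, w, hw, rfl⟩ : ∃ x ∈ t, ∃ w ∈ (K : Set G), x * w = y := by
        simpa only [Set.mem_iUnion, Set.mem_image, exists_prop] using hy
      -- `k x w = x (x⁻¹ k x) w`
      have h1 : k * (x * w) = x * ((x⁻¹ * k * x) * w) := by group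
      rw [h1, hfK w hw, hfK _ (K.mul_mem (hk' x hx) hw)]
    · have hy' : k * y ∉ ⋃ x ∈ t, (fun k => x * k) '' (K : Set G) := by
        intro h
        apply hy
        obtain ⟨x, hx, w, hw, hxw⟩ : ∃ x ∈ t, ∃ w ∈ (K : Set G), x * w = k * y := by
          simpa only [Set.mem_iUnion, Set.mem_image, exists_prop] using h
        simp only [Set.mem_iUnion, Set.mem_image, exists_prop]
        refine ⟨x, hx, (x⁻¹ * k * x)⁻¹ * w, K.mul_mem (K.inv_mem (hk' x hx)) hw, ?_⟩
        have : y = k⁻¹ * (x * w) := by rw [hxw, inv_mul_cancel_left]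
        rw [this]; group
      rw [image_eq_zero_of_notMem_tsupport (fun h => hy (ht h)), image_eq_zero_of_notMem_tsupport (fun h => hy' (ht h))]

/-- **`π(F) ∘ π(k) = π(F)` for `F` right-invariant under a COMPACT subgroup `K ∋ k` and a HAAR measure `η`** (no unimodularity: a Haar measure is right-invariant
under compact subgroups, ★ `map_mul_right_eq_self_of_mem_isCompact`; substitution `g ↦ g k`). [cite: DeitmarEchterhoff2014, Lemma 1.6.3] -/
theorem _root_.ContRepresentation.integratedOperator_comp_apply_eq_self_of_mem_isCompact {G : Type*} [Group G] [TopologicalSpace G] [IsTopologicalGroup G] [LocallyCompactSpace G]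
    [MeasurableSpace G] [BorelSpace G] [SecondCountableTopology G]
    {V : Type*} [NormedAddCommGroup V] [InnerProductSpace ℂ V] [CompleteSpace V] {π : ContRepresentation ℂ G V}
    (hu : π.IsUnitary) (hc : π.IsStronglyContinuous) (η : Measure G) [η.IsHaarMeasure]
    (K : Subgroup G) (hK : IsCompact (K : Set G)) (F : C_c(G, ℂ)) (hF : ∀ k ∈ K, ∀ x, F (x * k) = F x) {k : G} (hk : k ∈ K) :
    π.integratedOperator hu hc η F ∘L π k = π.integratedOperator hu hc η F := by
  ext v
  rw [ContinuousLinearMap.comp_apply, ContRepresentation.integratedOperator_apply, ContRepresentation.integratedOperator_apply]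
  -- `∫ F(g) π(g) π(k) v dη(g) = ∫ φ(g k) dη(g)` with `φ(g) = F(g k⁻¹) π(g) v`, `= ∫ φ dη` by right-invariance under `k ∈ K`
  have hmap := map_mul_right_eq_self_of_mem_isCompact η hK hk
  have h1 : (fun g => F g • π g (π k v)) = fun g => (fun y => F (y * k⁻¹) • π y v) (MeasurableEquiv.mulRight k g) := by
    funext g
    rw [MeasurableEquiv.coe_mulRight]
    change F g • π g (π k v) = F (g * k * k⁻¹) • π (g * k) v
    rw [mul_inv_cancel_right, map_mul π, mul_apply_eq_comp]
  have h2 : ∫ g, (fun y => F (y * k⁻¹) • π y v) (MeasurableEquiv.mulRight k g) ∂η = ∫ y, F (y * k⁻¹) • π y v ∂(η.map (MeasurableEquiv.mulRight k)) :=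
    (integral_map_equiv (MeasurableEquiv.mulRight k) (fun y => F (y * k⁻¹) • π y v)).symm
  rw [h1, h2, MeasurableEquiv.coe_mulRight, hmap]
  refine integral_congr_ae (Eventually.of_forall fun y => ?_)
  change F (y * k⁻¹) • π y v = F y • π y v
  rw [hF k⁻¹ (K.inv_mem hk)]

end Literature.NumberTheory.Automorphic

end
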